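import Summits.CriticalPhenomena.PercolationContinuityZ3.Theorems.FK.Transplant.KNFreeSteps
import Summits.CriticalPhenomena.PercolationContinuityZ3.Theorems.FK.Transplant.FreeBoundaryHypothesesKN
import Summits.CriticalPhenomena.PercolationContinuityZ3.Theorems.FK.Transplant.KNFreePinningLawFK
import HarnessLib

/-!
# FK-continuity transplant, FT-06 (binder h_bad): `KNFreeBadRestr d q p` (record v2) and `KNFreeBadBound d q p`
# (v1) hold for `1 ≤ q`

Cell `fk-continuity` (bschramm), FRONTIER TRANSPLANT sub-cell, registry row FT-06 / BINDER-OWNERS row 7 (h_bad,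
owner fkt-p4); support file (`--supports stmt-CriticalPhenomena-4575`); builds on p205010 (kernel theorem, internal
audit signed; external expert review pending). HONEST FRAMING: the transplant `ufsc0_of_freeBoundaryHypothesis_r0`
this file serves is CONDITIONAL on the free-boundary penetration hypothesis FH (open at the same `p` for `q > 1`;
⇔ GRC Conj. (5.103) via the referee's calibration K1: "[C3a ∀ p > p_c(q)] ∧ C3b ⇒ p̂_c(q) = p_c(q) = GRC Conj (5.103)
= DT Question 5 (open for q ∈ (1,2))"; barrier note `Literature.Barriers.CriticalPhenomena.SamePFreeBoundaryCriteria`);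
it is a typed reduction, not a proof of FK continuity. THIS file DISCHARGES the PROVE binder h_bad of the record —
`KNFreeBadRestr` (FT-01b `FreeBoundaryHypothesesKN.lean`, the v2 vocabulary of `ufsc0_of_freeBoundaryHypothesis_r0`,
restricted corridor form) — and its v1 form `KNFreeBadBound` (FT-01), unconditionally: no named facts, no sorries,
standard axioms; `FH` does not occur in it; hypothesis `1 ≤ q` only (rule 5 of BINDER-OWNERS).

## What is here

* the (32)-FK estimate of `ValidFK` is stated under the law of `W₀` on the piece `E_i ∪ E_{w,v}`; read on the
  larger piece `Sx = E_i ∪ E_{w,v} ∪ E_{v,x}` it is the same number (fkt-p3's `fkLaw_eq_of_subset`, `KNFreeLawSupport.lean`,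
  from FT-05 (v) `rcMeasureW_map_image_sym2Map`, p243989: idle vertices of weight zero do not matter).
* `knFreeBadRestr` — **`1 ≤ q → KNFreeBadRestr d q p`** (the binder of record): FT-06's
  `real_badFK_le_of_corridorRestr` (KN Thm 6 Steps II–IV under the minimal law `P^x`, the chain (36)–(37) as exact
  pinning identities, Step IV fed by the RESTRICTED corridor inequality `FKCorridorRestrAt` at `T = cdOf S h e du`)
  instantiated with FT-06d's `isPinningLaw_fkLaw (S.Sx h e du)`;
* `knFreeBadBound` — `1 ≤ q → KNFreeBadBound d q p` (v1, unrestricted corridor form `FKCorridorAt`).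

## References

* G. Kozma, S. Nitzan, arXiv:2401.12397 (2024), §4 pp. 28–31 ((32), (33), (36), (37)). [KozmaNitzan2024]
* G. Grimmett, *The Random-Cluster Model*, Springer 2006: Thm. (3.7) p. 39; Lemma (4.13) p. 71. [Grimmett2006]
-/

noncomputable section

open MeasureTheory Finset
open scoped ENNReal Classical

namespace Summit.CriticalPhenomena.PercolationContinuityZ3.Theorems.FK

open Literature.Probability.Percolation Literature.Probability.LatticeModels
open Literature.Probability.Percolation.KozmaNitzan Literature.Probability.Percolation.GadgetSystem
open Transplant

variable {d : ℕ}

/-- **The PROVE binder `h_bad` of the record holds**: for `1 ≤ q`, `KNFreeBadRestr d q p` — after every FK-valid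
history, in every onward direction, the bad event has `P^x`-probability `≤ (1 - δ₂)^K + ε'` given the RESTRICTED FK
corridor inequality at `(δ, ε', r)` and the FK target inequality at `(δ₂, δ)` for the aspect-`2K` elongated
geometries with `2R ≤ s` (KN Theorem 6 Steps II–IV, pp. 28–31, under the minimal law; FT-06
`real_badFK_le_of_corridorRestr` with the instance FT-06d `isPinningLaw_fkLaw`). Unconditional; `FH` is not used.
[cite: KozmaNitzan2024, §4 pp. 28–31 ((33), (36), (37)), p. 24; Grimmett2006, Thm. (3.7)] -/
theorem knFreeBadRestr {q : ℝ} (hq : 1 ≤ q) (p : unitInterval) : KNFreeBadRestr d q p := by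
  intro S hSp ε' δ₂ hδ₂ R hcorr htgt hRs h e du hV hdu
  have hq0 : 0 < q := one_pos.trans_le hq
  have hL := isPinningLaw_fkLaw (S.Sx h e du) hq
  have hD := pairsF_subset_range_sym2Map (S.Sx h e du)
  have hdu' : du ∈ (geomTwin S).onward h (tgt e) := hdu
  have hHyp : (KSch.cdOf S h e du).Hyp S.p := KSch.Valid.cd_hyp (S := geomTwin S) (geomTwin_valid_of_validFK hV) hdu'
  -- (32)-FK read on `Sx ⊇ E_i ∪ E_{w,v}`
  have hsub : S.V h ∪ S.C.Ewv e.1 e.2 ⊆ S.Sx h e du := Finset.subset_union_left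
  have hW0 : FinSupp (S.W₀ h e) (S.V h ∪ S.C.Ewv e.1 e.2) := finSupp_restrW _ _
  have hreach0 : 1 - S.δc < (fkLaw (S.Sx h e du) (S.W₀ h e) q).real
      (⋃ t ∈ S.C.M (tgt e), openConn (0 : Site d) t) := by
    rw [fkLaw_eq_of_subset hsub hW0 hq0]
    exact hV.reach
  exact real_badFK_le_of_corridorRestr hV hdu hL hD hδ₂ hreach0 (hcorr (KSch.cdOf S h e du) hHyp le_rfl) htgt hRs

/-- The v1 form: for `1 ≤ q`, `KNFreeBadBound d q p` (unrestricted corridor inequality `FKCorridorAt`; FT-06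
`real_badFK_le_of_isPinningLaw`). Unconditional; `FH` is not used. [cite: KozmaNitzan2024, §4 pp. 28–31 ((33), (36), (37)); Grimmett2006, Thm. (3.7)] -/
theorem knFreeBadBound {q : ℝ} (hq : 1 ≤ q) (p : unitInterval) : KNFreeBadBound d q p := by
  intro S hSp ε' δ₂ hδ₂ R hcorr htgt hRs h e du hV hdu
  have hq0 : 0 < q := one_pos.trans_le hq
  have hL := isPinningLaw_fkLaw (S.Sx h e du) hq
  have hD := pairsF_subset_range_sym2Map (S.Sx h e du)
  have hsub : S.V h ∪ S.C.Ewv e.1 e.2 ⊆ S.Sx h e du := Finset.subset_union_left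
  have hW0 : FinSupp (S.W₀ h e) (S.V h ∪ S.C.Ewv e.1 e.2) := finSupp_restrW _ _
  have hreach0 : 1 - S.δc < (fkLaw (S.Sx h e du) (S.W₀ h e) q).real
      (⋃ t ∈ S.C.M (tgt e), openConn (0 : Site d) t) := by
    rw [fkLaw_eq_of_subset hsub hW0 hq0]
    exact hV.reach
  exact real_badFK_le_of_isPinningLaw hV hdu hL hD hδ₂ hreach0 hcorr htgt hRs

end Summit.CriticalPhenomena.PercolationContinuityZ3.Theorems.FK

end
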